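import Summits.ResolutionOfSingularities.ResolutionOfSingularities.Theorems.FrobeniusClosingSteerConeBinary
import HarnessLib

/-!
# Cone file 2 (W4.1, idea-3 CLAIM 6 support; res-L0-w41-plan-1 RULING 114d): the shear transports EVERY direction vector

W4.1, crux `Steer` (stmt-ResolutionOfSingularities-16345); support for res-L0-w41-idea-3 g5's CLAIM 6 (two-vertex lemma) via the shear
`θ_c` (`X_{i₀} ↦ c_{i₀}X_{i₀}`, `X_i ↦ X_i + c_iX_{i₀}`) of `…DescentSpaceShear.lean`, now for an ARBITRARY direction `v` (the card-7 file
treated `v = e_{i₀}` only): with `A_c` the matrix of `θ_c` (`A_c e_{i₀} = c`, `A_c e_i = e_i`; written out as the explicit vector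
`(A_c v)_i = v_i + c_i v_{i₀}`, `(A_c v)_{i₀} = c_{i₀} v_{i₀}` — no definitions),
* `genTransl_shear_vec` / `genTransl_unshear_vec`: `(θ_c P)(X + t v) = Θ_c (P(X + t A_c v))` and the inverse-shear twin;
* `isLineInvariant_shear_of_vec` / `isLineInvariant_unshear_of_vec`: line invariance along `A_c v` downstairs ⟺ along `v` upstairs;
* `shearVec_single_self` (`A_c e_{i₀} = c`), `shearVec_single_of_ne` (`A_c e_j = e_j`), `shearVec_unshearVec` (`A_c A_c⁻¹ e = e`),
  `isHomogeneous_shearForm` / `isHomogeneous_unshearForm` (the substituted forms are linear);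
* `mem_descentSpace_shear_of_vec`: `A_c v ∈ W(P) ⇒ v ∈ W(θ_c P)` (chain rule + the above).
Seat res-D-pv-007 AS res-L0-w41-stub-5. OURS (research support for an idea card; candidates, not facts); nothing here is a statement of
the manuscript under review [claim: Hironaka2017, status: under-review]; AI work, weaker than expert review. [cite: CossartPiltant2009, p. 9]
[folklore]
-/

noncomputable section

-- `Summit.<S>.<S>.…` duplicates the summit name by design (single-problem summit).
set_option linter.dupNamespace false

open MvPolynomial
open Summit.ResolutionOfSingularities.ResolutionOfSingularities.Theorems.SwitchingDichotomy.DescentSpace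

namespace Summit.ResolutionOfSingularities.ResolutionOfSingularities.Theorems.SwitchingDichotomy.Cone

universe u v

/-! ## §3 Shear transport for an arbitrary direction vector -/

section ShearVec

variable {κ : Type u} [Field κ] {σ : Type v} [DecidableEq σ]

/-- **The shear `θ_c` transports translation along ANY vector**: `(θ_c P)(X + t v) = Θ_c (P(X + t·A_c v))` with
`(A_c v)_i = v_i + c_i v_{i₀}` (`i ≠ i₀`), `(A_c v)_{i₀} = c_{i₀} v_{i₀}` (the matrix of `θ_c`: `A_c e_{i₀} = c`, `A_c e_i = e_i`).
`DescentSpace.genTransl_single_shear` is the case `v = e_{i₀}`. [folklore] -/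
theorem genTransl_shear_vec (c v : σ → κ) (i₀ : σ) (P : MvPolynomial σ κ) :
    genTransl κ v (aeval (fun i => if i = i₀ then C (c i₀) * X i₀ else X i + C (c i) * X i₀) P) =
      aeval (fun i => if i = i₀ then C (Polynomial.C (c i₀)) * X i₀
          else (X i : MvPolynomial σ (Polynomial κ)) + C (Polynomial.C (c i)) * X i₀)
        (genTransl κ (fun i => if i = i₀ then c i₀ * v i₀ else v i + c i * v i₀) P) := by
  induction P using MvPolynomial.induction_on with
  | C a => rw [aeval_C, MvPolynomial.algebraMap_eq, genTransl_C, genTransl_C, aeval_C, MvPolynomial.algebraMap_eq]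
  | add p q hp hq => rw [map_add, map_add, hp, hq, map_add, map_add]
  | mul_X p i hp =>
    rw [map_mul, map_mul, hp, map_mul, map_mul, aeval_X, genTransl_X, map_add, aeval_X, aeval_C,
      MvPolynomial.algebraMap_eq]
    congr 1
    by_cases hi : i = i₀
    · subst hi
      simp only [if_true, map_mul, genTransl_C, genTransl_X]
      ring
    · simp only [if_neg hi, map_add, map_mul, genTransl_C, genTransl_X]
      ring

/-- The same for the inverse shear `θ_c⁻¹` (`c_{i₀} ≠ 0` not needed for the identity itself): matrix `A_c⁻¹`,
`(A_c⁻¹ u)_i = u_i − c_i c_{i₀}⁻¹ u_{i₀}` (`i ≠ i₀`), `(A_c⁻¹ u)_{i₀} = c_{i₀}⁻¹ u_{i₀}`. [folklore] -/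
theorem genTransl_unshear_vec (c u : σ → κ) (i₀ : σ) (Q : MvPolynomial σ κ) :
    genTransl κ u (aeval (fun i => if i = i₀ then C (c i₀)⁻¹ * X i₀ else X i - C (c i * (c i₀)⁻¹) * X i₀) Q) =
      aeval (fun i => if i = i₀ then C (Polynomial.C (c i₀)⁻¹) * X i₀
          else (X i : MvPolynomial σ (Polynomial κ)) - C (Polynomial.C (c i * (c i₀)⁻¹)) * X i₀)
        (genTransl κ (fun i => if i = i₀ then (c i₀)⁻¹ * u i₀ else u i - c i * (c i₀)⁻¹ * u i₀) Q) := by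
  induction Q using MvPolynomial.induction_on with
  | C a => rw [aeval_C, MvPolynomial.algebraMap_eq, genTransl_C, genTransl_C, aeval_C, MvPolynomial.algebraMap_eq]
  | add p q hp hq => rw [map_add, map_add, hp, hq, map_add, map_add]
  | mul_X p i hp =>
    rw [map_mul, map_mul, hp, map_mul, map_mul, aeval_X, genTransl_X, map_add, aeval_X, aeval_C,
      MvPolynomial.algebraMap_eq]
    congr 1
    by_cases hi : i = i₀
    · subst hi
      simp only [if_true, map_mul, genTransl_C, genTransl_X]
      ring
    · simp only [if_neg hi, map_sub, map_mul, genTransl_C, genTransl_X]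
      ring

/-- **Forward transport of line invariance**: invariance along `A_c v` downstairs gives invariance along `v` of `θ_c P`.
[folklore] -/
theorem isLineInvariant_shear_of_vec {c v : σ → κ} {i₀ : σ} {P : MvPolynomial σ κ}
    (h : IsLineInvariant κ (fun i => if i = i₀ then c i₀ * v i₀ else v i + c i * v i₀) P) :
    IsLineInvariant κ v (aeval (fun i => if i = i₀ then C (c i₀) * X i₀ else X i + C (c i) * X i₀) P) := by
  unfold IsLineInvariant at *
  rw [genTransl_shear_vec, h, map_shear]

/-- **Backward transport**: invariance along `v` downstairs gives invariance along `A_c v` of `θ_c⁻¹ Q` (`c_{i₀} ≠ 0`).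
[folklore] -/
theorem isLineInvariant_unshear_of_vec {c v : σ → κ} {i₀ : σ} (hc : c i₀ ≠ 0) {Q : MvPolynomial σ κ}
    (h : IsLineInvariant κ v Q) :
    IsLineInvariant κ (fun i => if i = i₀ then c i₀ * v i₀ else v i + c i * v i₀)
      (aeval (fun i => if i = i₀ then C (c i₀)⁻¹ * X i₀ else X i - C (c i * (c i₀)⁻¹) * X i₀) Q) := by
  unfold IsLineInvariant at *
  rw [genTransl_unshear_vec]
  have hv : (fun i => if i = i₀ then (c i₀)⁻¹ * (fun i => if i = i₀ then c i₀ * v i₀ else v i + c i * v i₀) i₀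
      else (fun i => if i = i₀ then c i₀ * v i₀ else v i + c i * v i₀) i -
        c i * (c i₀)⁻¹ * (fun i => if i = i₀ then c i₀ * v i₀ else v i + c i * v i₀) i₀) = v := by
    funext i
    by_cases hi : i = i₀
    · subst hi; simp only [if_true]; field_simp
    · simp only [if_neg hi, if_true]; field_simp; ring
  rw [hv, h, map_unshear]

/-- `A_c e_{i₀} = c` … and `A_c e_j = e_j` for `j ≠ i₀`: the shear fixes the other coordinate vectors. [folklore] -/
theorem shearVec_single_of_ne (c : σ → κ) {i₀ j : σ} (hj : j ≠ i₀) :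
    (fun i => if i = i₀ then c i₀ * (Pi.single j (1 : κ) : σ → κ) i₀
      else (Pi.single j (1 : κ) : σ → κ) i + c i * (Pi.single j (1 : κ) : σ → κ) i₀) = Pi.single j 1 := by
  funext i
  by_cases hi : i = i₀
  · subst hi; simp [hj.symm]
  · simp [hi, Pi.single_apply, hj.symm]

/-- `A_c e_{i₀} = c`. [folklore] -/
theorem shearVec_single_self (c : σ → κ) (i₀ : σ) :
    (fun i => if i = i₀ then c i₀ * (Pi.single i₀ (1 : κ) : σ → κ) i₀
      else (Pi.single i₀ (1 : κ) : σ → κ) i + c i * (Pi.single i₀ (1 : κ) : σ → κ) i₀) = c := by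
  funext i
  by_cases hi : i = i₀
  · subst hi; simp
  · simp [hi]

/-- `A_c (A_c⁻¹ e) = e` for `c_{i₀} ≠ 0`, with `A_c⁻¹ e` written out. [folklore] -/
theorem shearVec_unshearVec {c : σ → κ} {i₀ : σ} (hc : c i₀ ≠ 0) (e : σ → κ) :
    (fun i => if i = i₀ then c i₀ * (fun i => if i = i₀ then (c i₀)⁻¹ * e i₀ else e i - c i * (c i₀)⁻¹ * e i₀) i₀
      else (fun i => if i = i₀ then (c i₀)⁻¹ * e i₀ else e i - c i * (c i₀)⁻¹ * e i₀) i +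
        c i * (fun i => if i = i₀ then (c i₀)⁻¹ * e i₀ else e i - c i * (c i₀)⁻¹ * e i₀) i₀) = e := by
  funext i
  by_cases hi : i = i₀
  · subst hi; simp only [if_true]; field_simp
  · simp only [if_neg hi, if_true]; field_simp; ring

/-- The shear's linear forms are forms of degree `1`. [folklore] -/
theorem isHomogeneous_shearForm (c : σ → κ) (i₀ i : σ) :
    ((if i = i₀ then C (c i₀) * X i₀ else X i + C (c i) * X i₀ : MvPolynomial σ κ)).IsHomogeneous 1 := by
  by_cases hi : i = i₀
  · rw [if_pos hi]; exact (isHomogeneous_X κ i₀).C_mul _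
  · rw [if_neg hi]; exact (isHomogeneous_X κ i).add ((isHomogeneous_X κ i₀).C_mul _)

/-- The inverse shear's linear forms are forms of degree `1`. [folklore] -/
theorem isHomogeneous_unshearForm (c : σ → κ) (i₀ i : σ) :
    ((if i = i₀ then C (c i₀)⁻¹ * X i₀ else X i - C (c i * (c i₀)⁻¹) * X i₀ : MvPolynomial σ κ)).IsHomogeneous 1 := by
  by_cases hi : i = i₀
  · rw [if_pos hi]; exact (isHomogeneous_X κ i₀).C_mul _
  · rw [if_neg hi]; exact (isHomogeneous_X κ i).sub ((isHomogeneous_X κ i₀).C_mul _)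

variable [Fintype σ]

/-- **Forward transport of the descent space along any vector**: `A_c v ∈ W(P) ⇒ v ∈ W(θ_c P)`. [folklore] -/
theorem mem_descentSpace_shear_of_vec {c v : σ → κ} {i₀ : σ} {P : MvPolynomial σ κ}
    (h : (fun i => if i = i₀ then c i₀ * v i₀ else v i + c i * v i₀) ∈ descentSpace κ P) :
    v ∈ descentSpace κ (aeval (fun i => if i = i₀ then C (c i₀) * X i₀ else X i + C (c i) * X i₀) P) := by
  obtain ⟨h1, h2⟩ := h
  -- the partials of `θ_c P` are `θ_c` of linear combinations of partials of `P`, all invariant along `A_c v`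
  have hoff : ∀ j, j ≠ i₀ → IsLineInvariant κ v
      (pderiv j (aeval (fun i => if i = i₀ then C (c i₀) * X i₀ else X i + C (c i) * X i₀) P)) := fun j hj => by
    rw [pderiv_shear_of_ne c hj]; exact isLineInvariant_shear_of_vec (h2 j)
  have hpiv : IsLineInvariant κ v
      (pderiv i₀ (aeval (fun i => if i = i₀ then C (c i₀) * X i₀ else X i + C (c i) * X i₀) P)) := by
    rw [pderiv_shear_self]
    exact IsLineInvariant.sum _ fun k _ => (isLineInvariant_shear_of_vec (h2 k)).smul _
  refine ⟨?_, fun j => ?_⟩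
  · -- `Σ_i v_i ∂_i (θ P) = θ (Σ_k (A_c v)_k ∂_k P) = 0`
    have hsum : (∑ i, v i • pderiv i (aeval (fun i => if i = i₀ then C (c i₀) * X i₀ else X i + C (c i) * X i₀) P)) =
        aeval (fun i => if i = i₀ then C (c i₀) * X i₀ else X i + C (c i) * X i₀)
          (∑ k, (fun i => if i = i₀ then c i₀ * v i₀ else v i + c i * v i₀) k • pderiv k P) := by
      -- left: split off the pivot and use the chain rules
      have hL : (∑ i, v i • pderiv i (aeval (fun i => if i = i₀ then C (c i₀) * X i₀ else X i + C (c i) * X i₀) P)) =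
          v i₀ • aeval (fun i => if i = i₀ then C (c i₀) * X i₀ else X i + C (c i) * X i₀) (∑ k, c k • pderiv k P) +
          ∑ i ∈ Finset.univ.erase i₀,
            v i • aeval (fun i => if i = i₀ then C (c i₀) * X i₀ else X i + C (c i) * X i₀) (pderiv i P) := by
        rw [← Finset.add_sum_erase _ _ (Finset.mem_univ i₀), pderiv_shear_self']
        congr 1
        exact Finset.sum_congr rfl fun i hi => by rw [pderiv_shear_of_ne c (Finset.ne_of_mem_erase hi)]
      -- right: split off the pivot inside `θ`
      have hR : (∑ k, (fun i => if i = i₀ then c i₀ * v i₀ else v i + c i * v i₀) k • pderiv k P) =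
          v i₀ • (∑ k, c k • pderiv k P) + ∑ k ∈ Finset.univ.erase i₀, v k • pderiv k P := by
        rw [← Finset.add_sum_erase _ _ (Finset.mem_univ i₀), Finset.smul_sum,
          ← Finset.add_sum_erase _ (fun k => v i₀ • (c k • pderiv k P)) (Finset.mem_univ i₀), add_assoc,
          ← Finset.sum_add_distrib]
        simp only [if_true]
        congr 1
        · rw [smul_smul, mul_comm]
        · refine Finset.sum_congr rfl fun k hk => ?_
          rw [if_neg (Finset.ne_of_mem_erase hk), smul_smul, ← add_smul, mul_comm, add_comm]
      rw [hL, hR, map_add, map_smul]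
      congr 1
      rw [map_sum]
      exact Finset.sum_congr rfl fun k _ => by rw [map_smul]
    rw [hsum, h1, map_zero]
  · by_cases hj : j = i₀
    · subst hj; exact hpiv
    · exact hoff j hj

end ShearVec

end Summit.ResolutionOfSingularities.ResolutionOfSingularities.Theorems.SwitchingDichotomy.Cone

end
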